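import Summits.QuantumFields.YangMills.Theorems.RationalShortRootRigidityDihedralDivision
import Summits.QuantumFields.YangMills.Theorems.RationalShortRootRigidityRadialOfPlaneRotation
import HarnessLib

/-!
# `RationalShortRootRigidity` — Step 2 helper (m7), part II: `D₃`-Chevalley in the plane

Helper lemma INSIDE the paper proof of crux `stmt-QuantumFields-23124` (`F4SubCurvatureDoor.RationalShortRootRigidity`,
LINE g15-A of planner ym-idea-3; prover notes HOME l15/PLANAR-LEMMA-DETAILED.md, Step (2a); free-hands menu II, item (m7),
statement typed in HOME l15/Helpers23124.lean as `Helpers.DihedralChevalley` — proved here DEF-FREE with that body verbatim):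

**Lemma** (`dihedralChevalley`).  A real polynomial `b(x,y)` that is even in `x` and invariant under the rotation by
`120°` is (as a function on `ℝ²`) a polynomial in `u₂ = x² + y²` and `u₃ = 3x²y − y³`.

Proof (elementary, by strong induction on the total degree; no invariant theory is invoked).  The restriction
`h(x) = b(x,0)` is an even real polynomial (evenness in `x`), so `h(x) = h₂(x²)` (`exists_polynomial_sq_of_even`,
p660676), with `2·deg h₂ = deg h ≤ totalDegree b`.  Then `P := b − h₂(u₂)` is again even and rotation invariant
(`u₂` is), has `totalDegree P ≤ totalDegree b`, and vanishes on the line `y = 0`; by the rotation it vanishes on the lines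
`y = ±√3·x` too, so `P = u₃ · Q` (part I, `exists_eq_u3_mul`).  Since `u₃ ≠ 0` is invariant, `Q` is invariant
(`eval_invariant_of_mul`: pass to the algebraic form of the invariance by `MvPolynomial.funext` and cancel `u₃` in the
domain `ℝ[x,y]`), and `totalDegree Q = totalDegree P − totalDegree u₃ < totalDegree b` (`totalDegree_mul_of_isDomain`).
By induction `Q = c₁(u₂,u₃)`, whence `b = h₂(u₂) + u₃·c₁(u₂,u₃)`.

Mathlib + part I + the tree lemma `exists_polynomial_sq_of_even`; THEOREMS ONLY (no definitions); no named facts; no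
`sorry`; default heartbeats.  Nothing about the crux 23124, the route's rung or the Yang–Mills mass gap is proved here.
Free-hands seat `ym-line-frs-p2` g10 (announced on the owner's bus 2026-08-28T19:55Z), `--supports stmt-QuantumFields-23124`.
-/

set_option autoImplicit false

namespace Summit.QuantumFields.YangMills.Theorems.RationalShortRootRigidity

open scoped BigOperators Polynomial

/-! ## 1. The invariants `u₂`, `u₃` under the rotation by `120°` -/

/-- `u₂ = x² + y²` is invariant under the rotation by `120°`. [folklore] -/
theorem u2_rot (x y : ℝ) :
    (-(1/2 : ℝ) * x - (Real.sqrt 3 / 2) * y) ^ 2 + ((Real.sqrt 3 / 2) * x - (1/2 : ℝ) * y) ^ 2 = x ^ 2 + y ^ 2 := by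
  have hs : Real.sqrt 3 ^ 2 = 3 := Real.sq_sqrt (by norm_num)
  linear_combination ((x ^ 2 + y ^ 2) / 4) * hs

/-- `u₃ = 3x²y − y³` is invariant under the rotation by `120°`. [folklore] -/
theorem u3_rot (x y : ℝ) :
    3 * (-(1/2 : ℝ) * x - (Real.sqrt 3 / 2) * y) ^ 2 * ((Real.sqrt 3 / 2) * x - (1/2 : ℝ) * y) -
        ((Real.sqrt 3 / 2) * x - (1/2 : ℝ) * y) ^ 3 = 3 * x ^ 2 * y - y ^ 3 := by
  have hs : Real.sqrt 3 ^ 2 = 3 := Real.sq_sqrt (by norm_num)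
  linear_combination (x ^ 2 * y + (Real.sqrt 3 * x - y) * (3 * y ^ 2 - x ^ 2) / 8) * hs

/-! ## 2. Evaluation bookkeeping -/

/-- Coordinate `1` of a point written in `if`-form (`simp` turns the coordinate-`0` test into `if True`). [folklore] -/
theorem if_one_eq {α : Type*} (A B : α) : (if (1 : Fin 2) = 0 then A else B) = B := if_neg (by decide)

/-- Two points of the plane agree iff their two coordinates agree. [folklore] -/
theorem pt_ext {f g : Fin 2 → ℝ} (h0 : f 0 = g 0) (h1 : f 1 = g 1) : f = g :=
  funext fun i => by fin_cases i; exacts [h0, h1]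

/-- `eval v (bind₁ f R) = eval (i ↦ eval v (f i)) R`. [folklore] -/
theorem eval_bind₁_eq (v : Fin 2 → ℝ) (f : Fin 2 → MvPolynomial (Fin 2) ℝ) (R : MvPolynomial (Fin 2) ℝ) :
    MvPolynomial.eval v (MvPolynomial.bind₁ f R) = MvPolynomial.eval (fun i => MvPolynomial.eval v (f i)) R :=
  MvPolynomial.eval₂Hom_bind₁ _ _ _ _

/-- `eval w (p(u)) = p(eval w u)` for a univariate `p` substituted at a multivariate `u`. [folklore] -/
theorem eval_polynomial_aeval (w : Fin 2 → ℝ) (u : MvPolynomial (Fin 2) ℝ) (p : ℝ[X]) :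
    MvPolynomial.eval w (Polynomial.aeval u p) = p.eval (MvPolynomial.eval w u) := by
  have h := Polynomial.aeval_algHom_apply (MvPolynomial.aeval w : MvPolynomial (Fin 2) ℝ →ₐ[ℝ] ℝ) u p
  rw [Polynomial.coe_aeval_eq_eval] at h
  exact h.symm

/-- Functional invariance of a product `u · Q` by an invariant non-zero factor `u` descends to `Q` (algebraic form of the
invariance by `MvPolynomial.funext`, then cancellation in the domain `ℝ[x,y]`). [folklore] -/
theorem eval_invariant_of_mul (u Q : MvPolynomial (Fin 2) ℝ) (hu : u ≠ 0)
    (f : Fin 2 → MvPolynomial (Fin 2) ℝ) (G : (Fin 2 → ℝ) → (Fin 2 → ℝ))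
    (hfG : ∀ v : Fin 2 → ℝ, (fun i => MvPolynomial.eval v (f i)) = G v)
    (hU : ∀ v : Fin 2 → ℝ, MvPolynomial.eval (G v) u = MvPolynomial.eval v u)
    (hP : ∀ v : Fin 2 → ℝ, MvPolynomial.eval (G v) (u * Q) = MvPolynomial.eval v (u * Q)) :
    ∀ v : Fin 2 → ℝ, MvPolynomial.eval (G v) Q = MvPolynomial.eval v Q := by
  have halg : ∀ R : MvPolynomial (Fin 2) ℝ,
      (∀ v : Fin 2 → ℝ, MvPolynomial.eval (G v) R = MvPolynomial.eval v R) → MvPolynomial.bind₁ f R = R := by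
    intro R hR
    apply MvPolynomial.funext
    intro v
    rw [eval_bind₁_eq, hfG, hR]
  have hQ : MvPolynomial.bind₁ f Q = Q := by
    have h1 := halg _ hP
    rw [map_mul, halg _ hU] at h1
    exact mul_left_cancel₀ hu h1
  intro v
  have := congrArg (MvPolynomial.eval v) hQ
  rw [eval_bind₁_eq, hfG] at this
  exact this

/-! ## 3. The Chevalley lemma for `D₃` in the plane -/

/-- **`D₃`-Chevalley in the plane** (m7; Step (2a) of the paper proof of 23124): a real polynomial in `(x,y)` that is
even in `x` and invariant under the rotation by `120°` is a polynomial in `u₂ = x² + y²` and `u₃ = 3x²y − y³`.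
The statement is the body of `Helpers.DihedralChevalley` (HOME l15/Helpers23124.lean) verbatim. [folklore] -/
theorem dihedralChevalley :
    ∀ b : MvPolynomial (Fin 2) ℝ,
      (∀ v : Fin 2 → ℝ, MvPolynomial.eval (fun i => if i = 0 then -v 0 else v 1) b = MvPolynomial.eval v b) →
      (∀ v : Fin 2 → ℝ, MvPolynomial.eval
          (fun i => if i = 0 then -(1/2 : ℝ) * v 0 - (Real.sqrt 3 / 2) * v 1
            else (Real.sqrt 3 / 2) * v 0 - (1/2 : ℝ) * v 1) b
          = MvPolynomial.eval v b) →
      ∃ c : MvPolynomial (Fin 2) ℝ, ∀ v : Fin 2 → ℝ,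
        MvPolynomial.eval v b =
          MvPolynomial.eval (fun i => if i = 0 then v 0 ^ 2 + v 1 ^ 2 else 3 * v 0 ^ 2 * v 1 - v 1 ^ 3) c := by
  -- strong induction on the total degree
  suffices H : ∀ (n : ℕ) (b : MvPolynomial (Fin 2) ℝ), b.totalDegree ≤ n →
      (∀ v : Fin 2 → ℝ, MvPolynomial.eval (fun i => if i = 0 then -v 0 else v 1) b = MvPolynomial.eval v b) →
      (∀ v : Fin 2 → ℝ, MvPolynomial.eval
          (fun i => if i = 0 then -(1/2 : ℝ) * v 0 - (Real.sqrt 3 / 2) * v 1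
            else (Real.sqrt 3 / 2) * v 0 - (1/2 : ℝ) * v 1) b
          = MvPolynomial.eval v b) →
      ∃ c : MvPolynomial (Fin 2) ℝ, ∀ v : Fin 2 → ℝ,
        MvPolynomial.eval v b =
          MvPolynomial.eval (fun i => if i = 0 then v 0 ^ 2 + v 1 ^ 2 else 3 * v 0 ^ 2 * v 1 - v 1 ^ 3) c by
    intro b hσ hρ
    exact H _ b le_rfl hσ hρ
  intro n
  induction n using Nat.strong_induction_on with
  | _ n IH =>
  intro b hb hσ hρ
  have hs : Real.sqrt 3 * Real.sqrt 3 = 3 := Real.mul_self_sqrt (by norm_num)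
  -- algebraic forms of the two maps (`x ↦ −x`; rotation by `120°`) evaluate to the maps
  have hfσ : ∀ v : Fin 2 → ℝ,
      (fun i => MvPolynomial.eval v
        ((fun j : Fin 2 => if j = 0 then -MvPolynomial.X 0 else (MvPolynomial.X 1 : MvPolynomial (Fin 2) ℝ)) i)) =
      fun i => if i = 0 then -v 0 else v 1 := fun v =>
    pt_ext (by simp only [if_true, map_neg, MvPolynomial.eval_X])
      (by simp only [if_one_eq, MvPolynomial.eval_X])
  have hfρ : ∀ v : Fin 2 → ℝ,
      (fun i => MvPolynomial.eval v
        ((fun j : Fin 2 => if j = 0 then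
            MvPolynomial.C (-(1/2 : ℝ)) * MvPolynomial.X 0 - MvPolynomial.C (Real.sqrt 3 / 2) * MvPolynomial.X 1
          else (MvPolynomial.C (Real.sqrt 3 / 2) * MvPolynomial.X 0 - MvPolynomial.C (1/2 : ℝ) * MvPolynomial.X 1 :
            MvPolynomial (Fin 2) ℝ)) i)) =
      fun i => if i = 0 then -(1/2 : ℝ) * v 0 - (Real.sqrt 3 / 2) * v 1
        else (Real.sqrt 3 / 2) * v 0 - (1/2 : ℝ) * v 1 := fun v =>
    pt_ext (by simp only [if_true, map_sub, map_mul, MvPolynomial.eval_C, MvPolynomial.eval_X])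
      (by simp only [if_one_eq, map_sub, map_mul, MvPolynomial.eval_C, MvPolynomial.eval_X])
  -- the invariants
  set u2 : MvPolynomial (Fin 2) ℝ := MvPolynomial.X 0 ^ 2 + MvPolynomial.X 1 ^ 2 with hu2
  set u3 : MvPolynomial (Fin 2) ℝ := 3 * MvPolynomial.X 0 ^ 2 * MvPolynomial.X 1 - MvPolynomial.X 1 ^ 3 with hu3
  have hu2_eval : ∀ v : Fin 2 → ℝ, MvPolynomial.eval v u2 = v 0 ^ 2 + v 1 ^ 2 := by
    intro v; simp only [hu2, map_add, map_pow, MvPolynomial.eval_X]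
  have hu3_eval : ∀ v : Fin 2 → ℝ, MvPolynomial.eval v u3 = 3 * v 0 ^ 2 * v 1 - v 1 ^ 3 := by
    intro v; simp only [hu3, map_sub, map_mul, map_pow, MvPolynomial.eval_X, map_ofNat]
  have hu3σ : ∀ v : Fin 2 → ℝ,
      MvPolynomial.eval (fun i => if i = 0 then -v 0 else v 1) u3 = MvPolynomial.eval v u3 := by
    intro v; rw [hu3_eval, hu3_eval]; simp only [if_true, if_one_eq]; ring
  have hu3ρ : ∀ v : Fin 2 → ℝ, MvPolynomial.eval
      (fun i => if i = 0 then -(1/2 : ℝ) * v 0 - (Real.sqrt 3 / 2) * v 1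
        else (Real.sqrt 3 / 2) * v 0 - (1/2 : ℝ) * v 1) u3 = MvPolynomial.eval v u3 := by
    intro v; rw [hu3_eval, hu3_eval]; simp only [if_true, if_one_eq]; exact u3_rot (v 0) (v 1)
  -- 1. the axis polynomial `h(x) = b(x,0)` is even: `h(x) = h₂(x²)`
  obtain ⟨h, hh, hdeg⟩ := exists_axis_polynomial b
  have heven : ∀ t : ℝ, h.eval (-t) = h.eval t := by
    intro t
    rw [← hh, ← hh]
    have hσgen : ∀ v w : Fin 2 → ℝ, (fun i => if i = 0 then -v 0 else v 1) = w →
        MvPolynomial.eval w b = MvPolynomial.eval v b := fun v w hw => by rw [← hw]; exact hσ v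
    exact hσgen _ _ (pt_ext (by simp only [if_true]) (by simp only [if_one_eq]))
  obtain ⟨h₂, hh₂⟩ := exists_polynomial_sq_of_even h heven
  have hdeg₂ : h₂.natDegree * 2 ≤ b.totalDegree := by
    have hcomp : h = h₂.comp (Polynomial.X ^ 2) := by
      apply Polynomial.funext
      intro t
      rw [Polynomial.eval_comp, Polynomial.eval_pow, Polynomial.eval_X, hh₂]
    have : h.natDegree = h₂.natDegree * 2 := by
      rw [hcomp, Polynomial.natDegree_comp, Polynomial.natDegree_X_pow]
    omega
  -- 2. `c₀ = h₂(u₂)` and `P = b − c₀`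
  set c₀ : MvPolynomial (Fin 2) ℝ := Polynomial.aeval u2 h₂ with hc₀
  have hc₀_eval : ∀ v : Fin 2 → ℝ, MvPolynomial.eval v c₀ = h₂.eval (v 0 ^ 2 + v 1 ^ 2) := by
    intro v; rw [hc₀, eval_polynomial_aeval, hu2_eval]
  have hc₀deg : c₀.totalDegree ≤ b.totalDegree :=
    (totalDegree_aeval_le u2 h₂).trans ((Nat.mul_le_mul_left _ totalDegree_u2_le).trans hdeg₂)
  set P : MvPolynomial (Fin 2) ℝ := b - c₀ with hP
  have hσP : ∀ v : Fin 2 → ℝ,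
      MvPolynomial.eval (fun i => if i = 0 then -v 0 else v 1) P = MvPolynomial.eval v P := by
    intro v
    rw [hP, map_sub, map_sub, hσ v, hc₀_eval, hc₀_eval]
    simp only [if_true, if_one_eq, neg_sq]
  have hρP : ∀ v : Fin 2 → ℝ, MvPolynomial.eval
      (fun i => if i = 0 then -(1/2 : ℝ) * v 0 - (Real.sqrt 3 / 2) * v 1
        else (Real.sqrt 3 / 2) * v 0 - (1/2 : ℝ) * v 1) P = MvPolynomial.eval v P := by
    intro v
    rw [hP, map_sub, map_sub, hρ v, hc₀_eval, hc₀_eval]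
    simp only [if_true, if_one_eq]
    rw [u2_rot]
  have hρPgen : ∀ v w : Fin 2 → ℝ, (fun i => if i = 0 then -(1/2 : ℝ) * v 0 - (Real.sqrt 3 / 2) * v 1
      else (Real.sqrt 3 / 2) * v 0 - (1/2 : ℝ) * v 1) = w →
      MvPolynomial.eval w P = MvPolynomial.eval v P := fun v w hw => by rw [← hw]; exact hρP v
  -- vanishing on the three lines `y = 0`, `y = −√3·x`, `y = √3·x`
  have h0 : ∀ x : ℝ, MvPolynomial.eval (fun i : Fin 2 => if i = 0 then x else 0) P = 0 := by
    intro x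
    rw [hP, map_sub, hh, hc₀_eval, hh₂]
    simp
  have h2 : ∀ x : ℝ, MvPolynomial.eval (fun i : Fin 2 => if i = 0 then x else -Real.sqrt 3 * x) P = 0 := by
    intro x
    have key := hρPgen (fun i => if i = 0 then -2 * x else 0) (fun i => if i = 0 then x else -Real.sqrt 3 * x)
      (pt_ext (by simp only [if_true, if_one_eq]; ring) (by simp only [if_true, if_one_eq]; ring))
    rw [h0] at key
    exact key
  have h1 : ∀ x : ℝ, MvPolynomial.eval (fun i : Fin 2 => if i = 0 then x else Real.sqrt 3 * x) P = 0 := by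
    intro x
    have key := hρPgen (fun i => if i = 0 then x else -Real.sqrt 3 * x)
      (fun i => if i = 0 then x else Real.sqrt 3 * x)
      (pt_ext (by simp only [if_true, if_one_eq]; linear_combination (x / 2) * hs)
        (by simp only [if_true, if_one_eq]; ring))
    rw [h2] at key
    exact key
  -- 3. `P = u₃ · Q`
  obtain ⟨Q, hQ⟩ := exists_eq_u3_mul P (fun x => by simp only [zero_mul]; exact h0 x) h1 h2
  by_cases hQ0 : Q = 0
  · -- `b = h₂(u₂)`
    refine ⟨Polynomial.aeval (MvPolynomial.X 0) h₂, fun v => ?_⟩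
    have hb : b = c₀ := by
      rw [hQ0, mul_zero] at hQ
      exact sub_eq_zero.1 hQ
    rw [hb, hc₀_eval, eval_polynomial_aeval, MvPolynomial.eval_X]
    simp only [if_true]
  · -- degrees: `totalDegree Q < n`
    have hdegQ : Q.totalDegree < n := by
      have h1 := MvPolynomial.totalDegree_mul_of_isDomain u3_ne_zero hQ0
      rw [← hQ] at h1
      have h2 : P.totalDegree ≤ b.totalDegree :=
        (MvPolynomial.totalDegree_sub _ _).trans (max_le le_rfl hc₀deg)
      have h3 := totalDegree_u3_pos
      omega
    -- invariance of `Q`, then the induction hypothesis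
    have hσQ := eval_invariant_of_mul u3 Q u3_ne_zero _ (fun v i => if i = 0 then -v 0 else v 1) hfσ hu3σ
      (fun v => by rw [← hQ]; exact hσP v)
    have hρQ := eval_invariant_of_mul u3 Q u3_ne_zero _
      (fun v i => if i = 0 then -(1/2 : ℝ) * v 0 - (Real.sqrt 3 / 2) * v 1
        else (Real.sqrt 3 / 2) * v 0 - (1/2 : ℝ) * v 1) hfρ hu3ρ (fun v => by rw [← hQ]; exact hρP v)
    obtain ⟨c₁, hc₁⟩ := IH Q.totalDegree hdegQ Q le_rfl hσQ hρQ
    refine ⟨Polynomial.aeval (MvPolynomial.X 0) h₂ + MvPolynomial.X 1 * c₁, fun v => ?_⟩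
    have hb : b = c₀ + u3 * Q := by rw [← hQ, hP]; ring
    rw [hb, map_add, map_mul, hc₀_eval, hc₁ v, hu3_eval, map_add, map_mul, eval_polynomial_aeval,
      MvPolynomial.eval_X, MvPolynomial.eval_X]
    simp only [if_true, if_one_eq]

end Summit.QuantumFields.YangMills.Theorems.RationalShortRootRigidity
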